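import Summits.Parity.GeneralizedHardyLittlewood.Theorems.RangeQualityExchangeCore

/-!
# Range–quality exchange (2/5): the CORE obstruction (lower side, conductors `4 ∣ q`), monotonicity, the quality dial

Part of the decomp-parity lens-5 g10 certificate «RangeQualityExchange» (NODE HOME/STATUS.md l.484, critic CLEARED l.490 =
CRITIC-LEDGER row 89, writer DECISION L7 l.491: zero credit, helper beneath the existing leaf UU 26853), landed from the lens hand
`HOME/decomp-parity-lens-5/g10/hand/RangeQualityExchange.lean` (sha16 fc7ece3ca225b2c0, 1301 lines, rc 0 · 0 sorry · standard axioms)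
VERBATIM by section in five files for the 400-line Theorems lint by the cell's prover-class seat census-1 g10
(`RangeQualityExchangeCore` → `RangeQualityExchangeCoreLower` → `RangeQualityExchangeRate` → `RangeQualityExchangeNecessity` →
`RangeQualityExchange`; vocabulary `Theorems/RangeQualityExchangeDefs.lean`, p772649).  The hand's `private` shift-pair dictionary
copies (of `Theorems/PairsToGHL/Negative/{ShiftPairDictionary,UnboundedSiegelZeros}.lean`, which do not build on the current farm
snapshot, remote:stale:unbuilt 2026-08-30) stay `private` and sit in the part(s) that use them.

This file: `not_uniformLowerUpTo_of_rangeReachingZerosFour`, `RangeReachingZeros(.Four).mono`, `tendsto_log_natCast_rpow`,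
`unboundedSiegelZeros_of_qualityAbove`.  [cite: MatomakiMerikoski2023, Theorem 1.3]
-/

open Finset Filter MeasureTheory
open scoped Topology ArithmeticFunction.vonMangoldt
open Literature.NumberTheory.Sieve Literature.Barriers.Parity
open Summit.Parity.GeneralizedHardyLittlewood.Theses

noncomputable section

namespace Summit.Parity.GeneralizedHardyLittlewood.RangeQualityExchange

/-! ## Private helper copies (see the module docstring; names and signatures identical to the unbuilt tree lemmas) -/

namespace Dictionary

/-! ### `𝔖(h) ≥ C₂ · h/φ(h)` for even `h` -/

/-- `m/φ(m) = ∏_{p ∣ m} p/(p-1)` (from `φ(m) ∏_{p ∣ m} p = m ∏_{p ∣ m} (p - 1)`). [folklore] -/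
private theorem self_div_totient_eq_prod {m : ℕ} (hm : m ≠ 0) :
    (m : ℝ) / (Nat.totient m : ℝ) = ∏ p ∈ m.primeFactors, ((p : ℝ) / ((p : ℝ) - 1)) := by
  have key := Nat.totient_mul_prod_primeFactors m
  have hφ : (0 : ℝ) < Nat.totient m := by
    exact_mod_cast Nat.totient_pos.mpr (Nat.pos_of_ne_zero hm)
  have hcast : (((∏ p ∈ m.primeFactors, (p - 1) : ℕ)) : ℝ) = ∏ p ∈ m.primeFactors, ((p : ℝ) - 1) := by
    rw [Nat.cast_prod]
    refine Finset.prod_congr rfl fun p hp => ?_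
    rw [Nat.cast_sub (Nat.prime_of_mem_primeFactors hp).one_le, Nat.cast_one]
  have keyR : (Nat.totient m : ℝ) * ∏ p ∈ m.primeFactors, (p : ℝ) =
      (m : ℝ) * ∏ p ∈ m.primeFactors, ((p : ℝ) - 1) := by
    have := congrArg (Nat.cast : ℕ → ℝ) key
    rw [Nat.cast_mul, Nat.cast_mul, hcast, Nat.cast_prod] at this
    exact this
  have hne : ∏ p ∈ m.primeFactors, ((p : ℝ) - 1) ≠ 0 := by
    refine Finset.prod_ne_zero_iff.mpr fun p hp => ?_
    have : (2 : ℝ) ≤ p := by exact_mod_cast (Nat.prime_of_mem_primeFactors hp).two_le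
    linarith
  rw [Finset.prod_div_distrib, div_eq_div_iff hφ.ne' hne]
  linarith [keyR]

/-- For even `m ≠ 0`: `C₂ · m/φ(m) ≤ 𝔖(m) = 2C₂ ∏_{p ∣ m, p > 2} (p-1)/(p-2)`, since
`m/φ(m) = 2 ∏_{p ∣ m, p > 2} p/(p-1)` and `p/(p-1) ≤ (p-1)/(p-2)`. [folklore] -/
private theorem twinPrimeConst_mul_le_goldbachSingularSeries {m : ℕ} (hm : Even m) (h0 : m ≠ 0) :
    twinPrimeConst * ((m : ℝ) / (Nat.totient m : ℝ)) ≤ goldbachSingularSeries m := by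
  rw [goldbachSingularSeries_of_even m hm, self_div_totient_eq_prod h0]
  have h2 : 2 ∈ m.primeFactors :=
    Nat.mem_primeFactors.mpr ⟨Nat.prime_two, even_iff_two_dvd.mp hm, h0⟩
  rw [← Finset.mul_prod_erase _ _ h2]
  have herase : m.primeFactors.erase 2 = m.primeFactors.filter (2 < ·) := by
    ext p
    simp only [Finset.mem_erase, Finset.mem_filter, Nat.mem_primeFactors]
    constructor
    · rintro ⟨hne, hp, hdvd, hm0⟩
      exact ⟨⟨hp, hdvd, hm0⟩, lt_of_le_of_ne hp.two_le (Ne.symm hne)⟩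
    · rintro ⟨⟨hp, hdvd, hm0⟩, h2p⟩
      exact ⟨h2p.ne', hp, hdvd, hm0⟩
  have hβ2 : ((2 : ℕ) : ℝ) / (((2 : ℕ) : ℝ) - 1) = 2 := by norm_num
  rw [herase, hβ2]
  have hC : 0 < twinPrimeConst := twinPrimeConst_pos_holds
  have hle : ∏ p ∈ m.primeFactors.filter (2 < ·), ((p : ℝ) / ((p : ℝ) - 1)) ≤
      ∏ p ∈ m.primeFactors.filter (2 < ·), (((p : ℝ) - 1) / ((p : ℝ) - 2)) := by
    refine Finset.prod_le_prod (fun p hp => ?_) (fun p hp => ?_)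
    · have : (3 : ℝ) ≤ p := by exact_mod_cast (Finset.mem_filter.mp hp).2
      exact div_nonneg (by linarith) (by linarith)
    · have hp3 : (3 : ℝ) ≤ p := by exact_mod_cast (Finset.mem_filter.mp hp).2
      rw [div_le_div_iff₀ (by linarith) (by linarith)]
      nlinarith
  calc twinPrimeConst * (2 * ∏ p ∈ m.primeFactors.filter (2 < ·), ((p : ℝ) / ((p : ℝ) - 1)))
      = 2 * twinPrimeConst * ∏ p ∈ m.primeFactors.filter (2 < ·), ((p : ℝ) / ((p : ℝ) - 1)) := by
        ring
    _ ≤ 2 * twinPrimeConst * ∏ p ∈ m.primeFactors.filter (2 < ·), (((p : ℝ) - 1) / ((p : ℝ) - 2)) :=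
        mul_le_mul_of_nonneg_left hle (by linarith)

end Dictionary

open Dictionary

/-- **Range-reaching zeros at `4 ∣ q` refute uniform LOWER pair-HL up to that range** (mod
Matomäki–Merikoski Theorem 1.3): at `h = q/2 ≤ R(q^V)` the correction factor is `-1`
(`mm_correction_half`), so `∑ Λ(n)Λ(n+q/2) ≤ K (h/φ(h)) N · 3δ` while the dial predicts
`≥ N𝔖(q/2) - (C₂/4)N ≥ C₂ (h/φ(h)) N - (C₂/4) N`. [cite: MatomakiMerikoski2023, Theorem 1.3] -/
theorem not_uniformLowerUpTo_of_rangeReachingZerosFour {R : ℕ → ℝ}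
    (hMM : MatomakiMerikoski2023_pairCorrelation) (hZ : RangeReachingZerosFour R) :
    ¬ UniformLowerUpTo R := by
  intro hG
  have hC₂ : 0 < twinPrimeConst := twinPrimeConst_pos_holds
  obtain ⟨K, hK, hMM'⟩ := hMM 1 le_rfl (1 / 10) (by norm_num) 1 one_pos
  set δ : ℝ := twinPrimeConst / (12 * K) with hδ
  have hδpos : 0 < δ := by positivity
  obtain ⟨N₀, hN₀⟩ := hG (twinPrimeConst / 4) (by positivity)
  have hT1 : ∀ᶠ η : ℝ in atTop, Real.exp (-1 * Real.sqrt (10 * Real.log η)) ≤ δ := by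
    have h1 : Tendsto (fun η : ℝ => Real.exp (-1 * Real.sqrt (10 * Real.log η))) atTop (𝓝 0) := by
      refine Real.tendsto_exp_atBot.comp ?_
      have : Tendsto (fun η : ℝ => Real.sqrt (10 * Real.log η)) atTop atTop :=
        Real.tendsto_sqrt_atTop.comp (Real.tendsto_log_atTop.const_mul_atTop (by norm_num))
      simpa using this.const_mul_atTop_of_neg (by norm_num : (-1 : ℝ) < 0)
    exact (h1.eventually (gt_mem_nhds hδpos)).mono fun _ h => h.le
  have hT3 : ∀ᶠ X : ℝ in atTop, Real.exp (-1 * Real.log X ^ (3 / 5 - 1 / 10 : ℝ)) ≤ δ := by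
    have h1 : Tendsto (fun X : ℝ => Real.exp (-1 * Real.log X ^ (3 / 5 - 1 / 10 : ℝ))) atTop
        (𝓝 0) := by
      refine Real.tendsto_exp_atBot.comp ?_
      have : Tendsto (fun X : ℝ => Real.log X ^ (3 / 5 - 1 / 10 : ℝ)) atTop atTop :=
        (tendsto_rpow_atTop (by norm_num)).comp Real.tendsto_log_atTop
      simpa using this.const_mul_atTop_of_neg (by norm_num : (-1 : ℝ) < 0)
    exact (h1.eventually (gt_mem_nhds hδpos)).mono fun _ h => h.le
  obtain ⟨η₁, hη₁⟩ := eventually_atTop.mp hT1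
  obtain ⟨X₁, hX₁⟩ := eventually_atTop.mp hT3
  obtain ⟨q, inst, χ, η, V, hq, hη, h4, ⟨hprim, hquad, hη10, hL⟩, hV10, hVη, hreach⟩ :=
    hZ δ hδpos η₁ (max N₀ (max ⌈X₁⌉₊ 2))
  have hqN₀ : N₀ ≤ q := le_of_max_le_left hq
  have hqX₁ : ⌈X₁⌉₊ ≤ q := le_of_max_le_left (le_of_max_le_right hq)
  have hq2 : 2 ≤ q := le_of_max_le_right (le_of_max_le_right hq)
  have hqpos : 0 < q := by omega
  have hq4 : 4 ≤ q := Nat.le_of_dvd hqpos h4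
  have hheven : Even (q / 2) := ⟨q / 4, by omega⟩
  have hh0 : q / 2 ≠ 0 := by omega
  have hh1 : 1 ≤ q / 2 := by omega
  set N : ℕ := q ^ V with hN
  have hNpos : 0 < N := pow_pos hqpos V
  have hNr : (0 : ℝ) < N := by exact_mod_cast hNpos
  have hqN : q ≤ N := by
    calc q = q ^ 1 := (pow_one q).symm
      _ ≤ q ^ V := Nat.pow_le_pow_right hqpos (by omega)
  have hhN : q / 2 ≤ N := (Nat.div_le_self q 2).trans hqN
  set X : ℝ := (q : ℝ) ^ (V : ℝ) with hXdef
  have hXN : X = (N : ℝ) := by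
    rw [hXdef, hN, Real.rpow_natCast, Nat.cast_pow]
  have hA : ((q / 2 : ℕ) : ℝ) ≤ 1 * X := by
    rw [hXN, one_mul]; exact_mod_cast hhN
  have hV10r : (10 : ℝ) ≤ (V : ℝ) := by exact_mod_cast hV10
  have hM := hMM' q hq2 χ hprim hquad η hη10 hL (V : ℝ) X hV10r hXdef (q / 2) hh1 hA
  rw [mm_correction_half (by omega) h4, hXN, Nat.floor_natCast] at hM
  have hGq := hN₀ N (hqN₀.trans hqN) (q / 2) hh0 hheven hhN hreach
  set S : ℝ := ∑ n ∈ Icc 1 N, Λ n * Λ (n + q / 2) with hS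
  set 𝔖 : ℝ := goldbachSingularSeries (q / 2) with h𝔖
  set ρ : ℝ := ((q / 2 : ℕ) : ℝ) / (Nat.totient (q / 2) : ℝ) with hρ
  have hρ1 : 1 ≤ ρ := by
    have hφpos : (0 : ℝ) < (Nat.totient (q / 2) : ℝ) := by
      exact_mod_cast Nat.totient_pos.mpr (by omega)
    rw [hρ, le_div_iff₀ hφpos, one_mul]
    exact_mod_cast Nat.totient_le (q / 2)
  have hρ0 : 0 ≤ ρ := zero_le_one.trans hρ1
  have h𝔖ρ : twinPrimeConst * ρ ≤ 𝔖 :=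
    twinPrimeConst_mul_le_goldbachSingularSeries hheven hh0
  have hE1 : Real.exp (-1 * Real.sqrt ((V : ℝ) * Real.log η)) ≤ δ := by
    have hlogη : 0 ≤ Real.log η := Real.log_nonneg (by linarith)
    have h10V : 10 * Real.log η ≤ (V : ℝ) * Real.log η := mul_le_mul_of_nonneg_right hV10r hlogη
    have hs := Real.sqrt_le_sqrt h10V
    exact le_trans (Real.exp_le_exp.mpr (by linarith)) (hη₁ η hη)
  have hX₁N : X₁ ≤ (N : ℝ) :=
    (Nat.le_ceil X₁).trans (by exact_mod_cast hqX₁.trans hqN)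
  have hE3 := hX₁ (N : ℝ) hX₁N
  have hKρN : 0 ≤ K * ρ * (N : ℝ) := mul_nonneg (mul_nonneg hK.le hρ0) hNr.le
  have key : (N : ℝ) * 𝔖 ≤ K * ρ * N * (3 * δ) + twinPrimeConst / 4 * N := by
    have hM' : |S - (N : ℝ) * 𝔖 * 0| ≤ K * ρ * N * (3 * δ) :=
      hM.trans (mul_le_mul_of_nonneg_left (by linarith) hKρN)
    have hb := le_abs_self (S - (N : ℝ) * 𝔖 * 0)
    linarith
  have h3δ : K * ρ * (N : ℝ) * (3 * δ) = (N : ℝ) * (twinPrimeConst * ρ / 4) := by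
    rw [hδ]; field_simp; ring
  rw [h3δ] at key
  have hfin : 𝔖 ≤ twinPrimeConst * ρ / 4 + twinPrimeConst / 4 := by
    have h' : (N : ℝ) * 𝔖 ≤ (N : ℝ) * (twinPrimeConst * ρ / 4 + twinPrimeConst / 4) := by linarith
    exact le_of_mul_le_mul_left h' hNr
  have hCρ : twinPrimeConst * 1 ≤ twinPrimeConst * ρ := mul_le_mul_of_nonneg_left hρ1 hC₂.le
  linarith

/-- Range-reaching is monotone in the range. [folklore] -/
theorem RangeReachingZeros.mono {R R' : ℕ → ℝ} (hRR' : ∀ N, R N ≤ R' N) (h : RangeReachingZeros R) :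
    RangeReachingZeros R' := by
  intro δ hδ η₀ q₀
  obtain ⟨q, inst, χ, η, V, hq, hη, hz, hV, hVη, hreach⟩ := h δ hδ η₀ q₀
  exact ⟨q, inst, χ, η, V, hq, hη, hz, hV, hVη, hreach.trans (hRR' _)⟩

/-- Range-reaching is monotone in the range (conductors `4 ∣ q`). [folklore] -/
theorem RangeReachingZerosFour.mono {R R' : ℕ → ℝ} (hRR' : ∀ N, R N ≤ R' N)
    (h : RangeReachingZerosFour R) : RangeReachingZerosFour R' := by
  intro δ hδ η₀ q₀
  obtain ⟨q, inst, χ, η, V, hq, hη, h4, hz, hV, hVη, hreach⟩ := h δ hδ η₀ q₀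
  exact ⟨q, inst, χ, η, V, hq, hη, h4, hz, hV, hVη, hreach.trans (hRR' _)⟩

/-! ## The quality dial -/



/-- `(log q)^B → ∞` along `q → ∞` for `B > 0`. [folklore] -/
theorem tendsto_log_natCast_rpow {B : ℝ} (hB : 0 < B) :
    Tendsto (fun q : ℕ => Real.log (q : ℝ) ^ B) atTop atTop :=
  (tendsto_rpow_atTop hB).comp (Real.tendsto_log_atTop.comp tendsto_natCast_atTop_atTop)

/-- For `B > 0`, quality above `(log q)^B` is unbounded quality. [folklore] -/
theorem unboundedSiegelZeros_of_qualityAbove {B : ℝ} (hB : 0 < B) (h : QualityAbove B) :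
    UnboundedSiegelZeros := by
  intro η₀ q₀
  obtain ⟨q₁, hq₁⟩ := eventually_atTop.mp ((tendsto_log_natCast_rpow hB).eventually_ge_atTop η₀)
  obtain ⟨q, inst, χ, η, hq, hqual, hz⟩ := h (max q₀ q₁)
  exact ⟨q, inst, χ, η, le_of_max_le_left hq, (hq₁ q (le_of_max_le_right hq)).trans hqual, hz⟩

end Summit.Parity.GeneralizedHardyLittlewood.RangeQualityExchange
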